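import Literature.AlgebraicGeometry.Motives.ProjectiveManifoldAlgebraisation
import Literature.AlgebraicGeometry.Motives.ProjectiveManifoldRegularStalks
import Literature.AlgebraicGeometry.Motives.ProjectiveManifoldSmoothOfRegular
import Literature.AlgebraicGeometry.Resolution.SmoothStalksRegular
import Literature.AlgebraicGeometry.HodgeTheory.HypersurfaceSectionComplementMorse
import Literature.NumberTheory.Transcendental.AnalytificationChartsProofs
import Literature.Geometry.GeometricMeasureTheory.HausdorffLipschitzCover
import Mathlib.Topology.MetricSpace.HausdorffDimension
import HarnessLib

/-!
# Projective manifolds, III: the algebraisation of an embedded compact complex manifold is a smooth projective variety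

Final file of the algebraisation package `Literature.AlgebraicGeometry.Motives.ProjectiveManifold`
(re-homed verbatim from `Summits/HodgeConjecture/HodgeConjecture/Theorems/SecondaryPeriodsRiemannWeightOneStubAlgebraisationSmooth.lean`
and `…StubAlgebraisationSmoothDimension.lean`, route `SecondaryPeriods`, crux `RiemannWeightOne`,
where they were first proved — the headline `stub_algebraisationSmooth` is
`isSmoothProjective_of_isAnalytification` here; Literature cannot import Summits; the packaged form
`exists_smoothProjectiveVariety_of_immersion` — Remmert + Chow + Serre in one statement — is added).

**Serre, GAGA §2 n°6 Prop. 3 and Cor. 2** for an embedded manifold: a REDUCED closed subscheme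
`ι : X ↪ ℙᴺ_ℂ` whose complex points are analytified by a compact connected complex `n`-manifold
`M` (`φ : M ≃ₜ X(ℂ)` pulling regular functions back to holomorphic ones), compatibly with a
holomorphic injective immersion `F : M → ℙ(ℂ^{N+1})` (`ι(ℂ) ∘ φ = projPoint ∘ F`), is smooth
projective of dimension `n` over `ℂ`.

Assembly of the parts: (G4) `LocalSmoothness.isRegularLocalRing_stalk` (every local ring at a
complex point is regular of dimension `≥ n` — transversal finite projection, continuity of roots,
Nakayama), (G5) `Dimension.relativeDimension_le` (the relative dimension is `≤ n`), and (R)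
`isSmoothProjective_of_forall_isRegularLocalRing` (smoothness over the perfect field `ℂ` from
regular local rings at the closed points, one relative dimension since `X(ℂ) ≅ M` is connected).
The degenerate case `N = 0` (`ℙ⁰` a point, so `M` and `X(ℂ)` are points and `n = 0`) is treated
apart through generic smoothness of the integral `X`.

## References

* [SerreGAGA1956] J.-P. Serre, Géométrie algébrique et géométrie analytique, Ann. Inst. Fourier 6
  (1956), §2 n°6 Prop. 3 and Cor. 2.
-/

noncomputable section


namespace Literature.AlgebraicGeometry.Motives.ProjectiveManifold

open scoped TensorProduct Manifold ContDiff LinearAlgebra.Projectivization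
open CategoryTheory _root_.AlgebraicGeometry
open Literature.AlgebraicGeometry.Motives
open Literature.NumberTheory.Transcendental (IsAnalytification projPoint)

namespace Dimension

open scoped Manifold ContDiff _root_.Topology ENNReal
open CategoryTheory _root_.AlgebraicGeometry Filter Set Function
open Literature.AlgebraicGeometry.Motives Literature.AlgebraicGeometry.Motives.AlgPoints
open Literature.NumberTheory.Transcendental (IsAnalytification)
open Literature.AlgebraicGeometry.HodgeTheory
open AffineChart

/-- **The relative dimension of an analytified smooth scheme is at most the dimension of the
manifold.** [cite: SerreGAGA1956, §2 n°6 Prop. 3 and Cor. 2] -/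
theorem relativeDimension_le {n e : ℕ} {M : Type} [TopologicalSpace M] [ChartedSpace (Fin n → ℂ) M]
    [IsManifold 𝓘(ℂ, Fin n → ℂ) ω M] {X : SchemeOver ℂ} [LocallyOfFiniteType X.hom] [SmoothOfRelativeDimension e X.hom]
    {φ : M → ComplexPoints X} (hφ : IsAnalytification (Fin n → ℂ) X n φ) (m₀ : M) : e ≤ n := by
  obtain ⟨c, hP₀c, ⟨U₁, x, hsrc, hcoord⟩, -⟩ :=
    Literature.NumberTheory.Transcendental.exists_algebraicChart_holds X e (φ m₀)
  set ec := chartOfAnalytification hφ m₀ with hec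
  have hm₀src : φ m₀ ∈ ec.source := mem_chartOfAnalytification_source hφ m₀
  set z₀ := ec (φ m₀) with hz₀
  -- the open set where the chart expression of `c` is defined
  set T : Set (Fin n → ℂ) := ec.target ∩ ec.symm ⁻¹' c.source with hT
  have hTo : IsOpen T := ec.isOpen_inter_preimage_symm c.open_source
  have hz₀T : z₀ ∈ T := ⟨ec.map_source hm₀src, by
    show ec.symm z₀ ∈ c.source
    rw [hz₀, ec.left_inv hm₀src]
    exact hP₀c⟩
  set g : (Fin n → ℂ) → (Fin e → ℂ) := c ∘ ec.symm with hg
  -- `g` is `C¹` on `T` (its coordinates are regular functions along the analytification)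
  have hgC : ContDiffOn ℂ ω g T := by
    rw [hg, contDiffOn_pi]
    intro i
    have hsub : T ⊆ ec.target ∩ ec.symm ⁻¹' {Q | Q.pt ∈ (↑U₁ : X.left.Opens)} :=
      fun z hz => ⟨hz.1, hsrc hz.2⟩
    refine ((contDiffOn_chartOfAnalytification hφ m₀ U₁ (x i)).mono hsub).congr fun z hz => ?_
    exact hcoord _ hz.2 i
  have hgR : ContDiffOn ℝ 1 g T := (hgC.restrict_scalars ℝ).of_le (by norm_cast)
  -- a ball inside `T`
  obtain ⟨r, hr, hball⟩ := Metric.isOpen_iff.1 hTo z₀ hz₀T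
  have hdim_le : dimH (g '' Metric.ball z₀ r) ≤ (2 * n : ℕ) := by
    calc dimH (g '' Metric.ball z₀ r) ≤ dimH (Metric.ball z₀ r) :=
          (hgR.mono hball).dimH_image_le (convex_ball z₀ r) Subset.rfl
      _ ≤ dimH (Set.univ : Set (Fin n → ℂ)) := dimH_mono (Set.subset_univ _)
      _ = (2 * n : ℕ) := by rw [Real.dimH_univ_eq_finrank, Literature.Geometry.GeometricMeasureTheory.finrank_real_pi_complex]
  -- the image is open and non-empty, hence of full dimension `2e`
  have hopen : IsOpen (g '' Metric.ball z₀ r) := by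
    rw [hg, Set.image_comp]
    refine c.isOpen_image_of_subset_source ?_ fun P ⟨z, hz, hzP⟩ => hzP ▸ (hball hz).2
    exact ec.symm.isOpen_image_of_subset_source Metric.isOpen_ball fun z hz => (hball hz).1
  have hmem : g '' Metric.ball z₀ r ∈ 𝓝 (g z₀) :=
    hopen.mem_nhds ⟨z₀, Metric.mem_ball_self hr, rfl⟩
  have hdim_eq : dimH (g '' Metric.ball z₀ r) = (2 * e : ℕ) := by
    rw [Real.dimH_of_mem_nhds hmem, Literature.Geometry.GeometricMeasureTheory.finrank_real_pi_complex]
  rw [hdim_eq] at hdim_le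
  have h : 2 * e ≤ 2 * n := by exact_mod_cast hdim_le
  omega

/-- A `ℂ`-linear injection `ℂⁿ → ℂ⁰` forces `n = 0`. [folklore] -/
private theorem eq_zero_of_injective_linearMap {n : ℕ} (f : (Fin n → ℂ) →ₗ[ℂ] (Fin 0 → ℂ))
    (hf : Injective f) : n = 0 := by
  by_contra hn
  have hlt : 0 < n := Nat.pos_of_ne_zero hn
  have h1 : (Pi.single (⟨0, hlt⟩ : Fin n) (1 : ℂ) : Fin n → ℂ) ≠ 0 := by
    intro h
    have := congrFun h ⟨0, hlt⟩
    simp at this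
  exact h1 (hf (Subsingleton.elim _ _))

end Dimension

namespace Smoothness

/-- **Positive `N`: the local rings at complex points are regular, of dimension `≥ n`** (part (G4)
at every point, `φ` being onto). [cite: SerreGAGA1956, §2 n°6 Prop. 3 and Cor. 2] -/
theorem regular_of_succ {n N' : ℕ} {M : Type} [TopologicalSpace M] [ConnectedSpace M]
    [ChartedSpace (Fin n → ℂ) M] [IsManifold 𝓘(ℂ, Fin n → ℂ) ω M]
    {X : SchemeOver ℂ} (ι : X ⟶ projectiveSpace (N' + 1) ℂ) [IsClosedImmersion ι.left] [IsReduced X.left]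
    (F : M → ℙ ℂ (Fin (N' + 2) → ℂ)) (hF : ContMDiff 𝓘(ℂ, Fin n → ℂ) 𝓘(ℂ, Fin (N' + 1) → ℂ) ω F)
    (hFimm : ∀ x, Function.Injective (mfderiv 𝓘(ℂ, Fin n → ℂ) 𝓘(ℂ, Fin (N' + 1) → ℂ) F x))
    {φ : M → ComplexPoints X} (hφ : IsAnalytification (Fin n → ℂ) X n φ)
    (hcomp : ∀ m, AlgPoints.map ι (φ m) = projPoint (N' + 1) (F m)) :
    (∀ P : ComplexPoints X, IsRegularLocalRing (X.left.presheaf.stalk P.pt)) ∧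
      ∀ m₀ : M, ∃ e : ℕ, n ≤ e ∧ ringKrullDim (X.left.presheaf.stalk (φ m₀).pt) = e := by
  have key := fun m₀ : M => LocalSmoothness.isRegularLocalRing_stalk hφ ι F hcomp m₀
    (hF.mdifferentiable (by simp) m₀) (hFimm m₀)
  refine ⟨fun P => ?_, fun m₀ => (key m₀).2⟩
  obtain ⟨m, rfl⟩ := hφ.isHomeomorph.surjective P
  exact (key m).1

/-- **`N = 0`: `X` is smooth and `n = 0`.** `ℙ⁰(ℂ)` is a point, so `X(ℂ)` is a single point;
the smooth locus of the integral `X` (part (I)) is a dense open, so it contains a closed point,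
i.e. the point of `X(ℂ)`, hence every closed point, and `X` is smooth (`ℂ` Jacobson); the
immersion into the `0`-dimensional `ℙ⁰` forces `n = 0`. [folklore] -/
private theorem smooth_of_zero {n : ℕ} {M : Type} [TopologicalSpace M] [ConnectedSpace M]
    [ChartedSpace (Fin n → ℂ) M] [IsManifold 𝓘(ℂ, Fin n → ℂ) ω M]
    {X : SchemeOver ℂ} (ι : X ⟶ projectiveSpace 0 ℂ) [IsClosedImmersion ι.left] [IsReduced X.left]
    (F : M → ℙ ℂ (Fin 1 → ℂ))
    (hFimm : ∀ x, Function.Injective (mfderiv 𝓘(ℂ, Fin n → ℂ) 𝓘(ℂ, Fin 0 → ℂ) F x))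
    {φ : M → ComplexPoints X} (hφ : IsAnalytification (Fin n → ℂ) X n φ) :
    Smooth X.hom ∧ n = 0 := by
  haveI : IsProper X.hom := by rw [← Over.w ι]; infer_instance
  haveI : LocallyOfFiniteType X.hom := inferInstance
  haveI : LocallyOfFinitePresentation X.hom :=
    LocallyOfFinitePresentation.iff_locallyOfFiniteType.mpr inferInstance
  haveI : IsIntegral X.left := isIntegral_of_isAnalytification hφ
  have m₀ : M := Classical.arbitrary M
  refine ⟨?_, Dimension.eq_zero_of_injective_linearMap (mfderiv 𝓘(ℂ, Fin n → ℂ) 𝓘(ℂ, Fin 0 → ℂ) F m₀).toLinearMap (hFimm m₀)⟩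
  -- `X(ℂ)` is a single point
  haveI := Literature.AlgebraicGeometry.HodgeTheory.HypersurfaceSectionComplement.subsingleton_complexPoints_of_closedImmersion_projectiveSpace_zero ι
  have hsub : ∀ P Q : ComplexPoints X, P = Q := fun P Q => Subsingleton.elim P Q
  -- a closed point of the dense open smooth locus
  haveI := ComplexPoints.jacobsonSpace_left (X := X)
  obtain ⟨y, hy, hyc⟩ := nonempty_inter_closedPoints
    X.hom.dense_smoothLocus_of_perfectField.nonempty X.hom.smoothLocus.2.isLocallyClosed
  rw [← ComplexPoints.range_pt] at hyc
  obtain ⟨P₀, rfl⟩ := hyc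
  -- every closed point is smooth, hence `X` is smooth
  rw [← Scheme.Hom.smoothLocus_eq_top_iff]
  by_contra hne
  have hne' : ((X.hom.smoothLocus : Set X.left)ᶜ).Nonempty := by
    by_contra h
    rw [Set.not_nonempty_iff_eq_empty, Set.compl_empty_iff] at h
    exact hne (TopologicalSpace.Opens.ext h)
  obtain ⟨z, hz, hzc⟩ := nonempty_inter_closedPoints hne'
    X.hom.smoothLocus.isOpen.isClosed_compl.isLocallyClosed
  rw [← ComplexPoints.range_pt] at hzc
  obtain ⟨Q, rfl⟩ := hzc
  rw [hsub Q P₀] at hz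
  exact hz hy

/-- **From smoothness to `IsSmoothProjective n X`.** If the closed subscheme `X ⊆ ℙᴺ_ℂ` is smooth,
analytified by the connected complex `n`-manifold `M`, and every relative dimension it may have is
`≥ n`, then it is smooth projective of dimension `n`: `X(ℂ) ≅ M` is connected, so `X` is smooth of
one relative dimension `e` with `n ≤ e ≤ n` (part (G5)); its local rings at complex points are
regular (smooth over a field) of dimension `e = n`; part (R) concludes.
[cite: SerreGAGA1956, §2 n°6 Prop. 3 and Cor. 2] -/
theorem isSmoothProjective_of_smooth {n N : ℕ} {M : Type} [TopologicalSpace M] [ConnectedSpace M]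
    [ChartedSpace (Fin n → ℂ) M] [IsManifold 𝓘(ℂ, Fin n → ℂ) ω M]
    {X : SchemeOver ℂ} (ι : X ⟶ projectiveSpace N ℂ) [IsClosedImmersion ι.left] [Smooth X.hom]
    {φ : M → ComplexPoints X} (hφ : IsAnalytification (Fin n → ℂ) X n φ)
    (hlow : ∀ e : ℕ, SmoothOfRelativeDimension e X.hom → n ≤ e) : IsSmoothProjective n X := by
  haveI : IsProper X.hom := by rw [← Over.w ι]; infer_instance
  haveI : LocallyOfFiniteType X.hom := inferInstance
  haveI : ConnectedSpace (ComplexPoints X) := connectedSpace_complexPoints_of_isAnalytification hφ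
  obtain ⟨e, he⟩ :=
    Literature.AlgebraicGeometry.HodgeTheory.exists_smoothOfRelativeDimension_of_connectedSpace_complexPoints X
  haveI := he
  have m₀ : M := Classical.arbitrary M
  have hle : e ≤ n := Dimension.relativeDimension_le hφ m₀
  have hen : e = n := le_antisymm hle (hlow e he)
  subst hen
  have hreg : ∀ P : ComplexPoints X, IsRegularLocalRing (X.left.presheaf.stalk P.pt) := fun P =>
    Literature.AlgebraicGeometry.Resolution.isRegularLocalRing_stalk_of_smooth_of_field X.hom P.pt
  obtain ⟨V, hV, hPV, hsm⟩ := AlgPoints.exists_isStandardSmoothOfRelativeDimension_scalarRingHom e (φ m₀)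
  have hdim := ringKrullDim_stalk_eq_of_isStandardSmoothOfRelativeDimension hV hsm (φ m₀) hPV
  exact isSmoothProjective_of_forall_isRegularLocalRing ι hreg ⟨φ m₀, hdim⟩

end Smoothness

/-- **Serre, GAGA §2 n°6 Prop. 3 and Cor. 2** (statement verbatim from the Summits-side crux
`RiemannWeightOne`). A reduced closed subscheme `ι : X ↪ ℙᴺ_ℂ` whose complex points are
analytified by a compact connected complex `n`-manifold `M`, compatibly (`ι(ℂ) ∘ φ = projPoint ∘ F`)
with a holomorphic injective immersion `F : M → ℙ(ℂ^{N+1})`, is smooth projective of dimension `n`.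
For `N ≥ 1`: every local ring `𝒪_{X,P}` at a complex point is regular of dimension `≥ n` (parts
(G1)–(G4): a finite projection of an affine neighbourhood transversal at `P`, continuity of the
roots of the minimal polynomials of the vanishing separating functions, Nakayama), so `X` is
smooth, of one relative dimension `e ≥ n`, and `e ≤ n` by Hausdorff dimension in an algebraic
chart (part (G5)); part (R) concludes. For `N = 0` everything is a point.
[cite: SerreGAGA1956, §2 n°6 Prop. 3 and Cor. 2] -/
theorem isSmoothProjective_of_isAnalytification :
    ∀ ⦃n N : ℕ⦄ ⦃M : Type⦄ [TopologicalSpace M] [T2Space M] [CompactSpace M] [ConnectedSpace M]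
      [ChartedSpace (Fin n → ℂ) M] [IsManifold 𝓘(ℂ, Fin n → ℂ) ω M]
      (F : M → ℙ ℂ (Fin (N + 1) → ℂ)),
      ContMDiff 𝓘(ℂ, Fin n → ℂ) 𝓘(ℂ, Fin N → ℂ) ω F → Function.Injective F →
      (∀ x, Function.Injective (mfderiv 𝓘(ℂ, Fin n → ℂ) 𝓘(ℂ, Fin N → ℂ) F x)) →
      ∀ ⦃X : SchemeOver ℂ⦄ (ι : X ⟶ projectiveSpace N ℂ) [IsClosedImmersion ι.left]
        [IsReduced X.left] (φ : M → ComplexPoints X),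
        IsAnalytification (Fin n → ℂ) X n φ → (∀ m, AlgPoints.map ι (φ m) = projPoint N (F m)) →
        IsSmoothProjective n X := by
  intro n N M _ _ _ _ _ _ F hF _ hFimm X ι _ _ φ hφ hcomp
  cases N with
  | zero =>
    obtain ⟨hsm, hn⟩ := Smoothness.smooth_of_zero ι F hFimm hφ
    haveI := hsm
    exact Smoothness.isSmoothProjective_of_smooth ι hφ fun e _ => hn ▸ Nat.zero_le e
  | succ N' =>
    obtain ⟨hreg, hdim⟩ := Smoothness.regular_of_succ ι F hF hFimm hφ hcomp
    haveI : IsProper X.hom := by rw [← Over.w ι]; infer_instance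
    haveI : LocallyOfFiniteType X.hom := inferInstance
    haveI : Smooth X.hom := smooth_of_forall_complexPoints_isRegularLocalRing hreg
    refine Smoothness.isSmoothProjective_of_smooth ι hφ fun e he => ?_
    haveI := he
    have m₀ : M := Classical.arbitrary M
    obtain ⟨e₀, hne₀, hdim₀⟩ := hdim m₀
    obtain ⟨V, hV, hPV, hsm⟩ := AlgPoints.exists_isStandardSmoothOfRelativeDimension_scalarRingHom e (φ m₀)
    have hd := ringKrullDim_stalk_eq_of_isStandardSmoothOfRelativeDimension hV hsm (φ m₀) hPV
    rw [hdim₀] at hd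
    have hee : e₀ = e := by exact_mod_cast hd
    omega

/-- **The algebraisation of an embedded compact complex manifold is a smooth projective variety**
(Remmert + Chow + Serre GAGA, packaged): a compact connected complex manifold `M` (model `ℂⁿ`) with
an injective holomorphic immersion `F : M → ℙᴺ(ℂ)` is analytified — through `F` — by a reduced
closed subscheme `X ⊆ ℙᴺ_ℂ` (`ProjectiveManifold.exists_isAnalytification_of_immersion`) which is a
smooth projective VARIETY of dimension `n`: smooth projective (`isSmoothProjective_of_isAnalytification`)
and integral (`isIntegral_of_isAnalytification`). [cite: SerreGAGA1956, §2 n°6 Prop. 3 and Cor. 2, §3 Prop. 13]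
[cite: Chirka1989, §7.1 (Chow's theorem)] -/
theorem exists_smoothProjectiveVariety_of_immersion {n N : ℕ} {M : Type} [TopologicalSpace M]
    [T2Space M] [CompactSpace M] [ConnectedSpace M] [ChartedSpace (Fin n → ℂ) M]
    [IsManifold 𝓘(ℂ, Fin n → ℂ) ω M] (F : M → ℙ ℂ (Fin (N + 1) → ℂ))
    (hF : ContMDiff 𝓘(ℂ, Fin n → ℂ) 𝓘(ℂ, Fin N → ℂ) ω F) (hFinj : Function.Injective F)
    (hFimm : ∀ x, Function.Injective (mfderiv 𝓘(ℂ, Fin n → ℂ) 𝓘(ℂ, Fin N → ℂ) F x)) :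
    ∃ (X : SchemeOver ℂ) (ι : X ⟶ projectiveSpace N ℂ) (_ : IsClosedImmersion ι.left)
      (_ : IsReduced X.left) (φ : M → ComplexPoints X),
      IsAnalytification (Fin n → ℂ) X n φ ∧ (∀ m, AlgPoints.map ι (φ m) = projPoint N (F m)) ∧
        IsSmoothProjective n X ∧ IsIntegral X.left := by
  obtain ⟨X, ι, hι, hred, φ, hφ, hcomp⟩ := exists_isAnalytification_of_immersion F hF hFinj hFimm
  haveI := hι
  haveI := hred
  haveI : IsProper X.hom := by rw [← Over.w ι]; infer_instance
  haveI : LocallyOfFiniteType X.hom := inferInstance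
  exact ⟨X, ι, hι, hred, φ, hφ, hcomp,
    isSmoothProjective_of_isAnalytification F hF hFinj hFimm ι φ hφ hcomp,
    isIntegral_of_isAnalytification hφ⟩

end Literature.AlgebraicGeometry.Motives.ProjectiveManifold

end
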